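import Literature.NumberTheory.BostConnes.FiniteLevels
import Mathlib.NumberTheory.EulerProduct.Basic
import Mathlib.NumberTheory.ArithmeticFunction.Moebius
import Mathlib.Data.Finset.NatDivisors
import Mathlib.Analysis.SpecialFunctions.Pow.Deriv
import Mathlib.Analysis.SpecificLimits.Normed
import HarnessLib

/-!
# The Riemann gas (primon gas) of Julia and Spector at a finite set of primes

The *free Riemann gas* ([Julia1990]; independently [Spector1990]) is the second-quantised
system whose one-particle states are the primes `p` with energies `log p`: a many-boson state
is an integer `n = ∏ p^{m_p}` (unique factorisation = Fock basis), its energy is `log n`, and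
the canonical partition function is `Z_B(s) = ∑_n n^{-s} = ζ(s)` ([Julia1990]; [Spector1990]
§3 eq. (3.3); [SchumayerHutchinson2011] §V.A).  With *fermionic* statistics the states are the
squarefree integers, the grading `(-1)^F` is the Möbius function `μ` ([Spector1990] eq. (2.9)),
the graded partition function is `∑ μ(m) m^{-s} = 1/ζ(s)` and the Witten index of the
supersymmetric gas `H = H_B + H_F` is
`Δ = tr[(-1)^F e^{-βH}] = ζ(s) · ∑ μ(m) m^{-s} = 1` ([Spector1990] (3.1)–(3.4); [Spector1998]
§II); the thermal fermionic partition function is `Z_F = ∑ |μ(m)| m^{-s} = ζ(s)/ζ(2s)`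
([Spector1998] §III; [SchumayerHutchinson2011] §V.A), parafermions of order `k` give
`Z_k = ζ(s)/ζ(ks)` ([BakasBowick1991]; [Spector1998] §IV), and a fugacity / Beurling
deformation `p^{-s} ↦ z·p^{-s}` gives `∑ z^{Ω(n)} n^{-s} = ∏ (1 - z p^{-s})⁻¹`, `z = -1` being
the Liouville gas `ζ(2s)/ζ(s)` ([Julia1994]; [Arai2000] Thm 2.10, Cor. 2.11 (2.68)–(2.70)).

All of these are identities of Dirichlet series *with Euler products*, and every one of them
has an exact **finite-level** form in which the set of primes is a finite set `S` (the
"finite volume approximation … with a finite number of polymers" of [ContucciKnauf1996] §4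
eq. (14): `N_k = {p_1^{ε_1} ⋯ p_k^{ε_k}}`, `|N_k| = 2^k`, i.e. the divisors of `p_1 ⋯ p_k`; the
finite-dimensional Fock-space truncations `F^{(N)}` with
`Tr(P_N Γ_B(z) e^{-sH_B} P_N) = ∑_{m ∣ N} z^{γ(m)} m^{-s}` and
`Tr(R_N z^{N_F} e^{-sH_F} R_N) = det(1 + z e^{-sT_N})` of [Arai2000] Prop. 2.9 (2.56) and
(3.40)).  This file proves the finite-`S` identities, all unconditionally and exactly.  The
bosonic one, `∑_{n ∈ N_S} n^{-s} = ∏_{p∈S}(1-p^{-s})⁻¹` (`Re s > 0`), is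
`hasSum_partitionFunction` of `Literature.NumberTheory.BostConnes.FiniteLevels` (the
`S`-restricted Bost–Connes Hamiltonian *is* Julia's primon gas on the primes of `S`), imported
and reused here; it is also the case `z = 1` of the fugacity family of §5.

* §1 `sum_divisors_primorialPow_eq_prod` — the combinatorial engine: for a weight `w`
  multiplicative on positive integers with `w 1 = 1` and `M = ∏_{p∈S} p^e`,
  `∑_{d ∣ M} w(d) = ∏_{p∈S} ∑_{j≤e} w(p^j)`.
* §2 Fermionic gas at finite `S` ([ContucciKnauf1996] (14); [Arai2000] (3.40); [Spector1998]
  §III): `∑_{d ∣ N_S} z^{Ω(d)} d^{-s} = ∏_{p∈S}(1 + z p^{-s})` (`fermionPartitionFunction_eq_prod`,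
  `N_S = ∏_{p∈S} p`), in particular `∑_{d∣N_S} d^{-s} = ∏(1+p^{-s})` and Spector's `(-1)^F = μ`:
  `∑_{d∣N_S} μ(d) d^{-s} = ∏(1-p^{-s})` (`sum_divisors_moebius_eq_prod`); Spector's duality
  `Z_F(s) · Z_B(s)⁻¹ = Z_B(2s)⁻¹` at finite `S` (`fermion_mul_moebius_eq`).
* §3 Spector's Witten index at finite `S`: `Z_S(s) · ∑_{d∣N_S} μ(d) d^{-s} = 1`
  (`wittenIndex_eq_one`).
* §4 Parafermions of order `k` ([BakasBowick1991]; [Spector1998] §IV) at finite `S`: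
  `∑_{d ∣ ∏ p^{k-1}} d^{-s} = ∏_{p∈S} ∑_{j<k} (p^{-s})^j` and `Z_S(s)·∏(1-p^{-ks}) = ∏ ∑_{j<k} (p^{-s})^j`.
* §5 The Liouville gas ([Julia1994] fugacity `-1`; [Arai2000] (2.70)) at finite `S`:
  `∑_{n∈N_S} (-1)^{Ω(n)} n^{-s} = ∏_{p∈S}(1 + p^{-s})⁻¹` (`Re s > 0`; the case `z = -1` of the
  fugacity family `hasSum_fugacityPartitionFunction` of `…BostConnes.FiniteLevels`), and
  `∏(1+p^{-s})⁻¹ · Z_S(2s)⁻¹ = Z_S(s)⁻¹`.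
* §6 The internal energy / "trace formula" of the finite gas ([ContucciKnauf1996] §3.1:
  `ζ'(s)/ζ(s) = d/ds ln ζ(s) = -∑_p ln(p) ρ_s(p)`, "minus the expectation of the internal
  energy"; [SchumayerHutchinson2011] §V.A `⟨E⟩ = -∂_β ln Z_B`): for `Re s > 0`,
  `Z_S` is complex-differentiable with `Z_S'(s) = -Z_S(s) ∑_{p∈S} log p · p^{-s}/(1-p^{-s})`
  and `-Z_S'(s)/Z_S(s) = ∑_{p∈S} ∑_{m≥1} (log p) (p^{-s})^m` (the `S`-truncated von Mangoldt
  series `∑_{n ∈ N_S} Λ(n) n^{-s}`, prime by prime).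

What is NOT here: the thermodynamic limit `S ↑ {all primes}` (Mathlib's
`riemannZeta_eulerProduct`), Hagedorn / phase-transition statements, KMS states, the operator
algebra; no named facts are introduced (everything is proved).

## Sources (read at the page)

* [Spector1990] D. Spector, *Supersymmetry and the Möbius inversion function*, Comm. Math. Phys.
  127 (1990) 239–252: §2 (2.2)–(2.5) (Fock states `|N⟩`, `|N,d⟩`, `d` squarefree, `d ∣ N`),
  (2.6) `Δ = tr[(-1)^F e^{-βH}]`, (2.9) `μ(d) = ⟨N,d|(-1)^F|N,d⟩`, (2.11)–(2.12); §3 p. 245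
  `E_N = ω log N`, (3.1)–(3.4) `1 = [∑_N N^{-s}]·[∑_d μ(d) d^{-s}]`, bosonic piece `= ζ(s)`.
* [Spector1998] D. Spector, *Duality, partial supersymmetry, and arithmetic number theory*,
  J. Math. Phys. 39 (1998) 1919–1927 = hep-th/9710002: §II `tr e^{-βH_B} = ζ`,
  `tr (-1)^F e^{-βH_F} = ∑ μ(m) m^{-s} = 1/ζ`; §III `Z_F = ∑ |μ(m)| m^{-s} = ζ(s)/ζ(2s)`;
  §IV `Z_r = tr[(-1)^F e^{-β(H_B + rH_F)}] = ζ(βω)/ζ(rβω)` (parafermions of order `r`).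
* [BakasBowick1991] I. Bakas, M. J. Bowick, *Curiosities of arithmetic gases*, J. Math. Phys. 32
  (1991) 1881–1884 (parafermion gas of order `κ`: `Z_κ = ζ(s)/ζ(κs)`; statement read in
  [SchumayerHutchinson2011] §V.A and [Spector1998] §IV).
* [Julia1990] B. Julia, *Statistical theory of numbers*, in: Number Theory and Physics (Les
  Houches 1989), Springer Proc. Phys. 47 (1990) 276–293; [Julia1994] B. L. Julia, Physica A 203
  (1994) 425–436 (Beurling gas, fugacity; statements read in [SchumayerHutchinson2011] §V.A).
* [SchumayerHutchinson2011] D. Schumayer, D. A. W. Hutchinson, Rev. Mod. Phys. 83 (2011)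
  307–330 = arXiv:1101.3116, §V.A: `Z_B = ∑ n^{-s} = ζ(s)`, `⟨E⟩ = -∂_β ln Z_B`,
  `Z_F = ζ(s)/ζ(2s)`, fugacity `-1`: `ζ(2s)/ζ(s)`, `Z_κ = ζ(s)/ζ(κs)` [Bakas1991].
* [Arai2000] A. Arai, *Infinite-dimensional analysis and analytic number theory*, Acta Appl.
  Math. 63 (2000) 41–78 (Hokkaido preprint 450, 1999): Prop. 2.9 (2.56), Thm 2.10 (2.64),
  Cor. 2.11 (2.68)–(2.70); (3.40), (3.46) `(-1)^{N_F}Φ_m = μ(m)Φ_m`, Thm 3.9 (3.50)–(3.52).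
* [ContucciKnauf1996] P. Contucci, A. Knauf, *The low activity phase of some Dirichlet series*,
  J. Math. Phys. 37 (1996) 5458–5475 (ESI preprint 313): §3.1 multiplicative polymerization
  `ζ(s) = ∏(1-p^{-s})⁻¹`, `ζ'/ζ = -∑_p ln(p) ρ_s(p)`; §4 eq. (14)–(17) the finite sets `N_k`.
* [Apostol1976] T. M. Apostol, *Introduction to Analytic Number Theory* (Springer 1976), §2.9
  Thm 2.13 (a) (`f` multiplicative ⟹ `f(∏ p_i^{a_i}) = ∏ f(p_i^{a_i})`), §2.10 Thm 2.14
  (Dirichlet product of multiplicative functions is multiplicative; p. 35) — the combinatorial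
  engine of §1.
-/

noncomputable section

open Finset

open scoped ArithmeticFunction.Moebius ArithmeticFunction.Omega

namespace Literature.NumberTheory.BostConnes

/-! ## §0 Small helpers -/

/-- `‖p^{-s}‖ < 1` for a prime `p` and `Re s > 0`. [folklore] -/
private theorem norm_primePow_lt_one {p : ℕ} (hp : p.Prime) {s : ℂ} (hs : 0 < s.re) :
    ‖(p : ℂ) ^ (-s)‖ < 1 := by
  rw [Complex.norm_natCast_cpow_of_pos hp.pos, Complex.neg_re]
  exact Real.rpow_lt_one_of_one_lt_of_neg (by exact_mod_cast hp.one_lt) (by linarith)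

/-- `1 - p^{-s} ≠ 0` for a prime `p` and `Re s > 0`. [folklore] -/
private theorem one_sub_primePow_ne_zero {p : ℕ} (hp : p.Prime) {s : ℂ} (hs : 0 < s.re) :
    1 - (p : ℂ) ^ (-s) ≠ 0 := by
  intro h
  have h1 : (p : ℂ) ^ (-s) = 1 := by linear_combination -h
  have := norm_primePow_lt_one hp hs
  rw [h1, norm_one] at this
  exact lt_irrefl _ this

/-- `1 + p^{-s} ≠ 0` for a prime `p` and `Re s > 0`. [folklore] -/
private theorem one_add_primePow_ne_zero {p : ℕ} (hp : p.Prime) {s : ℂ} (hs : 0 < s.re) :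
    1 + (p : ℂ) ^ (-s) ≠ 0 := by
  intro h
  have h1 : (p : ℂ) ^ (-s) = -1 := by linear_combination h
  have := norm_primePow_lt_one hp hs
  rw [h1, norm_neg, norm_one] at this
  exact lt_irrefl _ this

/-- `(p^j)^{s} = (p^{s})^j` for natural `p, j` (the base is a natural number, so no branch
issue arises). [folklore] -/
private theorem natCast_pow_cpow (p j : ℕ) (s : ℂ) :
    ((p ^ j : ℕ) : ℂ) ^ s = ((p : ℂ) ^ s) ^ j := by
  induction j with
  | zero => simp
  | succ j ih =>
    rw [pow_succ, Nat.cast_mul, Complex.natCast_mul_natCast_cpow, ih, pow_succ]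

/-- `(p^{-s})^k = p^{-(k s)}`. [folklore] -/
private theorem primePow_pow (p : ℕ) (s : ℂ) (k : ℕ) :
    ((p : ℂ) ^ (-s)) ^ k = (p : ℂ) ^ (-((k : ℂ) * s)) := by
  rw [← Complex.cpow_nat_mul, mul_neg]

/-- The weight `w(n) = z^{Ω(n)} n^{-s}` is completely multiplicative on positive integers.
[folklore] -/
private theorem weight_mul (z s : ℂ) (a b : ℕ) (ha : a ≠ 0) (hb : b ≠ 0) :
    z ^ Ω (a * b) * ((a * b : ℕ) : ℂ) ^ (-s) =
      (z ^ Ω a * (a : ℂ) ^ (-s)) * (z ^ Ω b * (b : ℂ) ^ (-s)) := by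
  rw [ArithmeticFunction.cardFactors_mul ha hb, pow_add, Nat.cast_mul,
    Complex.natCast_mul_natCast_cpow]
  ring

/-- The weight at a prime power: `w(p^j) = (z p^{-s})^j`. [folklore] -/
private theorem weight_prime_pow {p : ℕ} (hp : p.Prime) (z s : ℂ) (j : ℕ) :
    z ^ Ω (p ^ j) * ((p ^ j : ℕ) : ℂ) ^ (-s) = (z * (p : ℂ) ^ (-s)) ^ j := by
  rw [ArithmeticFunction.cardFactors_apply_prime_pow hp, natCast_pow_cpow, mul_pow]

/-- The product of the (distinct) primes of `S` is squarefree. [folklore] -/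
private theorem squarefree_prod_primes {S : Finset ℕ} (hS : ∀ p ∈ S, p.Prime) :
    Squarefree (∏ p ∈ S, p) := by
  refine Finset.squarefree_prod_of_pairwise_isCoprime ?_ fun p hp => (hS p hp).prime.squarefree
  intro p hp q hq hpq
  exact Nat.coprime_iff_isRelPrime.mp ((Nat.coprime_primes (hS p hp) (hS q hq)).mpr hpq)

/-- `a^e` is coprime to `∏_{p ∈ S} p^e` when `a` is a prime outside the set `S` of primes.
[folklore] -/
private theorem coprime_pow_prod_pow {S : Finset ℕ} (hS : ∀ p ∈ S, p.Prime) {a : ℕ}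
    (ha : a.Prime) (haS : a ∉ S) (e : ℕ) :
    Nat.Coprime (a ^ e) (∏ p ∈ S, p ^ e) := by
  apply Nat.Coprime.pow_left
  rw [Nat.coprime_prod_right_iff]
  intro p hp
  refine Nat.Coprime.pow_right e ((Nat.coprime_primes ha (hS p hp)).mpr ?_)
  rintro rfl
  exact haS hp

/-! ## §1 The combinatorial engine: divisor sums over `∏_{p∈S} p^e` -/

/-- For a weight `w` that is multiplicative on positive integers and coprime `m, n`:
`∑_{d ∣ mn} w(d) = (∑_{a ∣ m} w(a)) (∑_{b ∣ n} w(b))` (the divisors of `mn` are the products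
`ab`, `a ∣ m`, `b ∣ n`, bijectively — Mathlib's `Nat.Coprime.divisors_mul`). [folklore] -/
private theorem sum_divisors_mul_of_coprime {w : ℕ → ℂ}
    (hw : ∀ a b : ℕ, a ≠ 0 → b ≠ 0 → w (a * b) = w a * w b) {m n : ℕ}
    (hmn : Nat.Coprime m n) :
    ∑ d ∈ (m * n).divisors, w d = (∑ a ∈ m.divisors, w a) * ∑ b ∈ n.divisors, w b := by
  rw [Nat.Coprime.divisors_mul hmn, Finset.sum_map, Finset.sum_mul_sum, ← Finset.sum_product',
    ← Finset.sum_attach (m.divisors ×ˢ n.divisors)]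
  refine Finset.sum_congr rfl fun x _ => ?_
  have hx := x.prop
  simp only [Finset.mem_coe, Finset.mem_product] at hx
  exact hw _ _ (Nat.pos_of_mem_divisors hx.1).ne' (Nat.pos_of_mem_divisors hx.2).ne'

/-- **Divisor sums over a primorial power.**  For a finite set `S` of primes, an exponent `e`
and a weight `w : ℕ → ℂ` multiplicative on positive integers with `w(1) = 1`,
`∑_{d ∣ ∏_{p∈S} p^e} w(d) = ∏_{p∈S} ∑_{j=0}^{e} w(p^j)`.
This is the finite-volume bookkeeping behind every "arithmetic gas" identity below: the state
space of the gas on the primes of `S` with occupation numbers `≤ e` is the divisor set of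
`∏_{p∈S} p^e` ([ContucciKnauf1996] §4 (14): `N_k = {p_1^{ε_1}⋯p_k^{ε_k} : ε_i ∈ {0,1}}`,
`|N_k| = 2^k`, is the case `e = 1`), and for a non-interacting Hamiltonian the partition sum
factorises prime by prime.  Mathematically it is Apostol's Thm 2.13 (a)
(`f(p_1^{a_1}⋯p_r^{a_r}) = f(p_1^{a_1})⋯f(p_r^{a_r})` for multiplicative `f`) applied to the
divisor sum `f = w ∗ u`, which is multiplicative by Thm 2.14 (proof on p. 35:
`h(mn) = ∑_{a∣m, b∣n} f(ab) g(mn/ab) = h(m) h(n)` for `(m,n) = 1`), together with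
`∑_{d ∣ p^a} w(d) = ∑_{j ≤ a} w(p^j)`. [cite: Apostol1976, Thm 2.13 (a) and Thm 2.14] -/
theorem sum_divisors_primorialPow_eq_prod {S : Finset ℕ} (hS : ∀ p ∈ S, p.Prime) (e : ℕ)
    {w : ℕ → ℂ} (hw1 : w 1 = 1) (hw : ∀ a b : ℕ, a ≠ 0 → b ≠ 0 → w (a * b) = w a * w b) :
    ∑ d ∈ (∏ p ∈ S, p ^ e).divisors, w d = ∏ p ∈ S, ∑ j ∈ range (e + 1), w (p ^ j) := by
  induction S using Finset.induction_on with
  | empty => simp [hw1]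
  | insert a S haS ih =>
    have ha : a.Prime := hS a (mem_insert_self a S)
    have hS' : ∀ p ∈ S, p.Prime := fun p hp => hS p (mem_insert_of_mem hp)
    rw [prod_insert haS, prod_insert haS,
      sum_divisors_mul_of_coprime hw (coprime_pow_prod_pow hS' ha haS e), ih hS',
      Nat.sum_divisors_prime_pow ha]

/-! ## §2 The fermionic Riemann gas at finite `S` -/

/-- **Fermionic primon gas at finite level, with fugacity** ([Arai2000] (3.40) with (3.46),
the finite trace `Tr(R_N z^{N_F} e^{-sH_F(ω_P)} R_N) = det(1 + z e^{-s(ω_P)_N})` on the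
`2^{ν(N)}`-dimensional fermion Fock piece, `N = N_S`; [ContucciKnauf1996] §4 (14) for the state
set `N_k`): for a finite set `S` of primes, `N_S := ∏_{p∈S} p`, and all `s, z ∈ ℂ`,
`∑_{d ∣ N_S} z^{Ω(d)} d^{-s} = ∏_{p∈S} (1 + z·p^{-s})`.
(Infinite version: [Arai2000] Thm 3.9 (3.50); `z = 1`: `Z_F = ζ(s)/ζ(2s)` of [Spector1998] §III.)
[cite: Arai2000, eq. (3.40) and Thm 3.9 (3.50)] -/
theorem fermionPartitionFunction_eq_prod {S : Finset ℕ} (hS : ∀ p ∈ S, p.Prime) (s z : ℂ) :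
    ∑ d ∈ (∏ p ∈ S, p).divisors, z ^ Ω d * (d : ℂ) ^ (-s) =
      ∏ p ∈ S, (1 + z * (p : ℂ) ^ (-s)) := by
  have h := sum_divisors_primorialPow_eq_prod hS 1 (w := fun n => z ^ Ω n * (n : ℂ) ^ (-s))
    (by simp) (fun a b ha hb => weight_mul z s a b ha hb)
  simp only [pow_one] at h
  rw [h]
  refine prod_congr rfl fun p hp => ?_
  rw [Finset.sum_range_succ, Finset.sum_range_one, weight_prime_pow (hS p hp),
    weight_prime_pow (hS p hp), pow_zero, pow_one]

/-- **Thermal fermionic partition function at finite `S`** (`z = 1`): the states are the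
squarefree `S`-numbers `d ∣ N_S` ([Spector1990] §2, `|d,d⟩`; [ContucciKnauf1996] (14)) and
`∑_{d ∣ N_S} d^{-s} = ∏_{p∈S} (1 + p^{-s})` — the finite-`S` form of
`Z_F = ∑ |μ(m)| m^{-s} = ζ(s)/ζ(2s)` ([Spector1998] §III; [SchumayerHutchinson2011] §V.A).
[cite: Spector1998, §III] -/
theorem sum_divisors_primorial_cpow_eq_prod {S : Finset ℕ} (hS : ∀ p ∈ S, p.Prime) (s : ℂ) :
    ∑ d ∈ (∏ p ∈ S, p).divisors, (d : ℂ) ^ (-s) = ∏ p ∈ S, (1 + (p : ℂ) ^ (-s)) := by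
  simpa using fermionPartitionFunction_eq_prod hS s 1

/-- **Spector's `(-1)^F = μ` at finite level** ([Spector1990] eq. (2.9): on the fermionic
states `|N,d⟩` the grading `(-1)^F` acts by the Möbius function `μ(d)`; [Arai2000] (3.46),
(3.52)): for a finite set `S` of primes,
`∑_{d ∣ N_S} μ(d) d^{-s} = ∏_{p∈S} (1 - p^{-s})` — the finite-`S` form of the graded
fermionic partition function `tr[(-1)^F e^{-βH_F}] = ∑ μ(m) m^{-s} = 1/ζ(s)`
([Spector1990] (3.3)–(3.4); [Spector1998] §II). [cite: Spector1990, eqs. (2.9), (3.3)–(3.4)] -/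
theorem sum_divisors_moebius_eq_prod {S : Finset ℕ} (hS : ∀ p ∈ S, p.Prime) (s : ℂ) :
    ∑ d ∈ (∏ p ∈ S, p).divisors, (μ d : ℂ) * (d : ℂ) ^ (-s) = ∏ p ∈ S, (1 - (p : ℂ) ^ (-s)) := by
  have h := fermionPartitionFunction_eq_prod hS s (-1)
  have hsq := squarefree_prod_primes hS
  rw [show ∏ p ∈ S, (1 - (p : ℂ) ^ (-s)) = ∏ p ∈ S, (1 + (-1) * (p : ℂ) ^ (-s)) from
    prod_congr rfl fun p _ => by ring, ← h]
  refine sum_congr rfl fun d hd => ?_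
  have hd' : Squarefree d := hsq.squarefree_of_dvd (Nat.dvd_of_mem_divisors hd)
  rw [ArithmeticFunction.moebius_apply_of_squarefree hd']
  push_cast
  ring

/-- **Spector's duality at finite `S`** ([Spector1998] §III, "partial supersymmetry":
`Z_F(s) = tr[(-1)^F e^{-β(H_B + 2H_F)}] = ζ(s)/ζ(2s)`, i.e. `Z_F(s)·ζ(s)⁻¹ = ζ(2s)⁻¹`): for a
finite set `S` of primes and every `s ∈ ℂ`,
`(∑_{d∣N_S} d^{-s}) · (∑_{d∣N_S} μ(d) d^{-s}) = ∏_{p∈S} (1 - p^{-2s})`, i.e.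
`∏(1+p^{-s})·∏(1-p^{-s}) = ∏(1-p^{-2s})`. [cite: Spector1998, §III] -/
theorem fermion_mul_moebius_eq {S : Finset ℕ} (hS : ∀ p ∈ S, p.Prime) (s : ℂ) :
    (∑ d ∈ (∏ p ∈ S, p).divisors, (d : ℂ) ^ (-s)) *
        ∑ d ∈ (∏ p ∈ S, p).divisors, (μ d : ℂ) * (d : ℂ) ^ (-s) =
      ∏ p ∈ S, (1 - (p : ℂ) ^ (-(2 * s))) := by
  rw [sum_divisors_primorial_cpow_eq_prod hS, sum_divisors_moebius_eq_prod hS, ← prod_mul_distrib]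
  refine prod_congr rfl fun p _ => ?_
  have h2 : (p : ℂ) ^ (-(2 * s)) = ((p : ℂ) ^ (-s)) ^ 2 := by
    rw [primePow_pow, Nat.cast_ofNat]
  rw [h2]; ring

/-! ## §3 Spector's Witten index at finite `S` -/

/-- **The Witten index of the supersymmetric Riemann gas is `1`, at every finite level**
([Spector1990] §3 (3.1)–(3.4): `Δ = tr[(-1)^F e^{-β(H_b+H_f)}] = tr[e^{-βH_b}]·tr[(-1)^F e^{-βH_f}]
= [∑_N N^{-s}]·[∑_d μ(d) d^{-s}] = 1`, `s = βω`; [Spector1998] §II).  At finite `S`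
(`Re s > 0`, so that the bosonic factor `Z_S(s) = ∑_{n∈N_S} n^{-s} = ∏_{p∈S}(1-p^{-s})⁻¹`
converges, `hasSum_partitionFunction`): `Z_S(s) · ∑_{d∣N_S} μ(d) d^{-s} = 1`.
[cite: Spector1990, §3 eqs. (3.1)–(3.4)] -/
theorem wittenIndex_eq_one {S : Finset ℕ} (hS : ∀ p ∈ S, p.Prime) {s : ℂ} (hs : 0 < s.re) :
    (∏ p ∈ S, (1 - (p : ℂ) ^ (-s))⁻¹) *
        ∑ d ∈ (∏ p ∈ S, p).divisors, (μ d : ℂ) * (d : ℂ) ^ (-s) = 1 := by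
  rw [sum_divisors_moebius_eq_prod hS, ← prod_mul_distrib]
  exact prod_eq_one fun p hp => inv_mul_cancel₀ (one_sub_primePow_ne_zero (hS p hp) hs)

/-! ## §4 Parafermions of order `k` at finite `S` -/

/-- **Parafermion gas of order `k` at finite level** ([BakasBowick1991]; [Spector1998] §IV:
occupation numbers `0, …, k-1`, `Z_k = ζ(s)/ζ(ks)`): for a finite set `S` of primes the states
are the divisors of `∏_{p∈S} p^{k-1}` and
`∑_{d ∣ ∏ p^{k-1}} d^{-s} = ∏_{p∈S} ∑_{j<k} (p^{-s})^j`  (`k ≥ 1`; `k = 2` is the fermionic gas,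
`k → ∞` the bosonic one). [cite: BakasBowick1991, parafermion partition function] -/
theorem parafermionPartitionFunction_eq_prod {S : Finset ℕ} (hS : ∀ p ∈ S, p.Prime) (s : ℂ)
    {k : ℕ} (hk : 1 ≤ k) :
    ∑ d ∈ (∏ p ∈ S, p ^ (k - 1)).divisors, (d : ℂ) ^ (-s) =
      ∏ p ∈ S, ∑ j ∈ range k, ((p : ℂ) ^ (-s)) ^ j := by
  have h := sum_divisors_primorialPow_eq_prod hS (k - 1) (w := fun n => (n : ℂ) ^ (-s))
    (by simp) (fun a b _ _ => by simp only [Nat.cast_mul, Complex.natCast_mul_natCast_cpow])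
  rw [h, Nat.sub_add_cancel hk]
  refine prod_congr rfl fun p _ => sum_congr rfl fun j _ => ?_
  exact natCast_pow_cpow p j (-s)

/-- **`Z_k = Z(s)/Z(ks)` at finite level** ([BakasBowick1991]; [Spector1998] §IV): for a finite
set `S` of primes and `Re s > 0`,
`Z_S(s) · ∏_{p∈S}(1 - p^{-ks}) = ∏_{p∈S} ∑_{j<k} (p^{-s})^j`, where
`Z_S(s) = ∏_{p∈S}(1-p^{-s})⁻¹` is the bosonic partition function and `∏(1-p^{-ks}) = Z_S(ks)⁻¹`.
[cite: Spector1998, §IV] -/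
theorem boson_mul_inv_boson_scaled_eq_parafermion {S : Finset ℕ} (hS : ∀ p ∈ S, p.Prime)
    {s : ℂ} (hs : 0 < s.re) (k : ℕ) :
    (∏ p ∈ S, (1 - (p : ℂ) ^ (-s))⁻¹) * ∏ p ∈ S, (1 - (p : ℂ) ^ (-((k : ℂ) * s))) =
      ∏ p ∈ S, ∑ j ∈ range k, ((p : ℂ) ^ (-s)) ^ j := by
  rw [← prod_mul_distrib]
  refine prod_congr rfl fun p hp => ?_
  have hne := one_sub_primePow_ne_zero (hS p hp) hs
  rw [← primePow_pow, ← geom_sum_mul_neg, inv_mul_eq_iff_eq_mul₀ hne, mul_comm]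

/-! ## §5 The Liouville gas (fugacity `-1`) at finite `S` -/

/-- **The Liouville gas (fugacity `-1`) at finite level** ([Julia1994]: "a boson primon gas
with fugacity `-1` … `Z'_B = ζ(2s)/ζ(s)`" as reported in [SchumayerHutchinson2011] §V.A;
[Arai2000] Thm 2.10 (2.64)–(2.66) and Cor. 2.11 (2.68)–(2.70):
`∑_N z^{γ(N)} N^{-s} = ∏_p (1 - z p^{-s})⁻¹` (`γ = Ω`), `D(s,λ) = ∑ λ(N) N^{-s} = ∏ (1 + p^{-s})⁻¹`;
[Spector1998] the bosonic index `tr[(-1)^{N_B} e^{-βH_B}] = ζ(2s)/ζ(s)`): for `S` finite and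
`Re s > 0`, `∑_{n ∈ N_S} (-1)^{Ω(n)} n^{-s} = ∏_{p∈S} (1 + p^{-s})⁻¹`.  The general fugacity
`z` (the Beurling gas, `|z| < 2^{Re s}`) is `hasSum_fugacityPartitionFunction` of
`Literature.NumberTheory.BostConnes.FiniteLevels`; this is its case `z = -1`.
[cite: Arai2000, Cor. 2.11 (2.70)] -/
theorem hasSum_liouvillePartitionFunction {S : Finset ℕ} (hS : ∀ p ∈ S, p.Prime) {s : ℂ}
    (hs : 0 < s.re) :
    HasSum (fun m : Nat.factoredNumbers S => (-1 : ℂ) ^ Ω (m : ℕ) * ((m : ℕ) : ℂ) ^ (-s))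
      (∏ p ∈ S, (1 + (p : ℂ) ^ (-s))⁻¹) := by
  have hs0 : -s ≠ 0 := by
    intro h
    rw [neg_eq_zero] at h
    rw [h] at hs
    simp at hs
  -- the Liouville weight `n ↦ (-1)^{Ω(n)} n^{-s}` as a monoid hom `ℕ →* ℂ`
  let f : ℕ →* ℂ :=
    { toFun := fun n => (-1 : ℂ) ^ Ω n * (n : ℂ) ^ (-s)
      map_one' := by simp
      map_mul' := fun a b => by
        rcases eq_or_ne a 0 with rfl | ha
        · simp [Complex.zero_cpow hs0]
        rcases eq_or_ne b 0 with rfl | hb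
        · simp [Complex.zero_cpow hs0]
        exact weight_mul (-1) s a b ha hb }
  have hf : ∀ {p : ℕ}, p.Prime → ‖f p‖ < 1 := by
    intro p hp
    show ‖(-1 : ℂ) ^ Ω p * (p : ℂ) ^ (-s)‖ < 1
    rw [ArithmeticFunction.cardFactors_apply_prime hp, pow_one, norm_mul, norm_neg, norm_one,
      one_mul]
    exact norm_primePow_lt_one hp hs
  have h := EulerProduct.summable_and_hasSum_factoredNumbers_prod_filter_prime_geometric hf S
  have hprod : ∏ p ∈ S, (1 - f p)⁻¹ = ∏ p ∈ S, (1 + (p : ℂ) ^ (-s))⁻¹ :=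
    prod_congr rfl fun p hp => by
      show (1 - (-1 : ℂ) ^ Ω p * (p : ℂ) ^ (-s))⁻¹ = _
      rw [ArithmeticFunction.cardFactors_apply_prime (hS p hp), pow_one, neg_one_mul,
        sub_neg_eq_add]
  rw [Finset.filter_true_of_mem hS, hprod] at h
  simpa only [f, MonoidHom.coe_mk, OneHom.coe_mk] using h.2

/-- The Witten-index identity with the bosonic factor written as the convergent state sum
over the `S`-numbers (`Re s > 0`; the bosonic sum `∑_{n ∈ N_S} n^{-s} = ∏_{p∈S}(1-p^{-s})⁻¹`
is `hasSum_partitionFunction` of `Literature.NumberTheory.BostConnes.FiniteLevels`, the `z = 1`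
case of `hasSum_fugacityPartitionFunction`): `(∑'_{n ∈ N_S} n^{-s}) · ∑_{d∣N_S} μ(d) d^{-s} = 1`
([Spector1990] (3.2)–(3.4): `1 = ∑_N ⟨N,1|e^{-βH_b}|N,1⟩ · ∑_d ⟨d,d|(-1)^F e^{-βH_f}|d,d⟩`).
[cite: Spector1990, §3 eqs. (3.1)–(3.4)] -/
theorem tsum_mul_sum_moebius_eq_one {S : Finset ℕ} (hS : ∀ p ∈ S, p.Prime) {s : ℂ}
    (hs : 0 < s.re) :
    (∑' m : Nat.factoredNumbers S, ((m : ℕ) : ℂ) ^ (-s)) *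
        ∑ d ∈ (∏ p ∈ S, p).divisors, (μ d : ℂ) * (d : ℂ) ^ (-s) = 1 := by
  rw [partitionFunction_eq_eulerProduct hS hs]
  exact wittenIndex_eq_one hS hs

/-- `∏_{p∈S}(1 + p^{-s})⁻¹ · Z_S(2s)⁻¹ = Z_S(s)⁻¹`, i.e. the Liouville gas is `Z_S(2s)/Z_S(s)`
with `Z_S(s) = ∏_{p∈S}(1-p^{-s})⁻¹` — the finite-`S` form of "fugacity `-1` gives
`ζ(2s)/ζ(s)`" ([SchumayerHutchinson2011] §V.A; [Arai2000] (2.70) with (2.69)); `Re s > 0`.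
[cite: Arai2000, Cor. 2.11 (2.69)–(2.70)] -/
theorem prod_inv_one_add_mul_eq {S : Finset ℕ} (hS : ∀ p ∈ S, p.Prime) {s : ℂ}
    (hs : 0 < s.re) :
    (∏ p ∈ S, (1 + (p : ℂ) ^ (-s))⁻¹) * ∏ p ∈ S, (1 - (p : ℂ) ^ (-(2 * s))) =
      ∏ p ∈ S, (1 - (p : ℂ) ^ (-s)) := by
  rw [← prod_mul_distrib]
  refine prod_congr rfl fun p hp => ?_
  have h2 : (p : ℂ) ^ (-(2 * s)) = ((p : ℂ) ^ (-s)) ^ 2 := by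
    rw [primePow_pow, Nat.cast_ofNat]
  have hfac : (1 : ℂ) - ((p : ℂ) ^ (-s)) ^ 2 = (1 + (p : ℂ) ^ (-s)) * (1 - (p : ℂ) ^ (-s)) := by
    ring
  rw [h2, hfac, ← mul_assoc, inv_mul_cancel₀ (one_add_primePow_ne_zero (hS p hp) hs), one_mul]

/-! ## §6 Internal energy: the logarithmic derivative of the finite partition function -/

/-- Derivative of one Euler factor: `d/ds (1 - p^{-s})⁻¹ = -(log p)·p^{-s}·(1-p^{-s})⁻²`
(`Re s > 0`). [folklore] -/
private theorem hasDerivAt_eulerFactor {p : ℕ} (hp : p.Prime) {s : ℂ} (hs : 0 < s.re) :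
    HasDerivAt (fun s : ℂ => (1 - (p : ℂ) ^ (-s))⁻¹)
      (-(Real.log p * (p : ℂ) ^ (-s)) / (1 - (p : ℂ) ^ (-s)) ^ 2) s := by
  have hp0 : (p : ℂ) ≠ 0 := by exact_mod_cast hp.ne_zero
  have hlog : ((Real.log p : ℝ) : ℂ) = Complex.log (p : ℂ) := Complex.natCast_log
  -- `s ↦ p^{-s}` has derivative `-(p^{-s} log p)` (chain rule with `s ↦ -s`)
  have h1 : HasDerivAt (fun s : ℂ => (p : ℂ) ^ (-s)) (-((p : ℂ) ^ (-s) * Complex.log p)) s :=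
    (((Complex.hasStrictDerivAt_const_cpow (x := (p : ℂ)) (y := -s) (Or.inl hp0)).hasDerivAt).comp
      s (hasDerivAt_neg s)).congr_deriv (by ring)
  -- `s ↦ 1 - p^{-s}`, then its inverse
  have h2 : HasDerivAt (fun s : ℂ => 1 - (p : ℂ) ^ (-s)) ((p : ℂ) ^ (-s) * Complex.log p) s :=
    (h1.const_sub 1).congr_deriv (by ring)
  refine (h2.inv (one_sub_primePow_ne_zero hp hs)).congr_deriv ?_
  rw [hlog]
  ring

/-- **The finite partition function is holomorphic on `Re s > 0` and its logarithmic
derivative is minus the internal energy** ([ContucciKnauf1996] §3.1: interpreting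
`ζ(s) = ∑ e^{-s ln n}` as a partition function, "`ζ'(s)/ζ(s)` is minus the expectation of the
internal energy", `ζ'(s)/ζ(s) = d/ds ln ζ(s) = -∑_{p} ln(p) ρ_s(p)` for the multiplicative
polymerization with activities `z_s(p) = 1/(p^s - 1)`; [SchumayerHutchinson2011] §V.A
`⟨E⟩ = -∂_β ln Z_B`).  At finite `S`, with `Z_S(s) = ∏_{p∈S}(1-p^{-s})⁻¹`:
`Z_S'(s) = -Z_S(s) · ∑_{p∈S} (log p)·p^{-s}/(1-p^{-s})` for `Re s > 0`
(note `p^{-s}/(1-p^{-s}) = 1/(p^s-1) = z_s(p)`). [cite: ContucciKnauf1996, §3.1] -/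
theorem hasDerivAt_partitionFunction {S : Finset ℕ} (hS : ∀ p ∈ S, p.Prime) {s : ℂ}
    (hs : 0 < s.re) :
    HasDerivAt (fun s : ℂ => ∏ p ∈ S, (1 - (p : ℂ) ^ (-s))⁻¹)
      (-(∏ p ∈ S, (1 - (p : ℂ) ^ (-s))⁻¹) *
        ∑ p ∈ S, Real.log p * (p : ℂ) ^ (-s) / (1 - (p : ℂ) ^ (-s))) s := by
  have h := HasDerivAt.fun_finsetProd (u := S) (x := s)
    (f := fun (p : ℕ) (s : ℂ) => (1 - (p : ℂ) ^ (-s))⁻¹)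
    (f' := fun p => -(Real.log p * (p : ℂ) ^ (-s)) / (1 - (p : ℂ) ^ (-s)) ^ 2)
    (fun p hp => hasDerivAt_eulerFactor (hS p hp) hs)
  refine h.congr_deriv ?_
  rw [neg_mul, Finset.mul_sum, ← Finset.sum_neg_distrib]
  refine sum_congr rfl fun p hp => ?_
  rw [← Finset.prod_erase_mul S (fun q => (1 - (q : ℂ) ^ (-s))⁻¹) hp, smul_eq_mul,
    div_eq_mul_inv, div_eq_mul_inv, pow_two, mul_inv]
  ring

/-- The occupation series of one mode: for a prime `p` and `Re s > 0`,
`∑_{m ≥ 1} (log p) (p^{-s})^m = (log p)·p^{-s}/(1 - p^{-s})` (geometric series; the `m`-th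
term is the weight `(log p) p^{-ms} = Λ(p^m) (p^m)^{-s}` of the prime power `p^m`).
[folklore] -/
private theorem hasSum_log_mul_primePow_pow {p : ℕ} (hp : p.Prime) {s : ℂ} (hs : 0 < s.re) :
    HasSum (fun m : ℕ => (Real.log p : ℂ) * ((p : ℂ) ^ (-s)) ^ (m + 1))
      (Real.log p * (p : ℂ) ^ (-s) / (1 - (p : ℂ) ^ (-s))) := by
  have hg := hasSum_geometric_of_norm_lt_one (norm_primePow_lt_one hp hs)
  have hfun : (fun m : ℕ => (Real.log p : ℂ) * ((p : ℂ) ^ (-s)) ^ (m + 1)) =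
      fun m : ℕ => ((Real.log p : ℂ) * (p : ℂ) ^ (-s)) * ((p : ℂ) ^ (-s)) ^ m := by
    ext m
    rw [pow_succ]
    ring
  rw [hfun, div_eq_mul_inv]
  exact hg.mul_left _

/-- **Trace formula of the finite Riemann gas / `S`-truncated von Mangoldt series**
([ContucciKnauf1996] §3.1 `-ζ'/ζ = ∑_p ln(p) ρ_s(p)`, prime powers as polymers with
activities `x^{-s}`; [SchumayerHutchinson2011] §V.A internal energy of the primon gas): for a
finite set `S` of primes and `Re s > 0`,
`-Z_S'(s)/Z_S(s) = ∑_{p∈S} ∑_{m≥1} (log p)·(p^{-s})^m`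
(`= ∑_{n ∈ N_S} Λ(n) n^{-s}`, the von Mangoldt function being supported on prime powers).
[cite: ContucciKnauf1996, §3.1] -/
theorem neg_logDeriv_partitionFunction {S : Finset ℕ} (hS : ∀ p ∈ S, p.Prime) {s : ℂ}
    (hs : 0 < s.re) :
    -(deriv (fun s : ℂ => ∏ p ∈ S, (1 - (p : ℂ) ^ (-s))⁻¹) s) /
        (∏ p ∈ S, (1 - (p : ℂ) ^ (-s))⁻¹) =
      ∑ p ∈ S, ∑' m : ℕ, (Real.log p : ℂ) * ((p : ℂ) ^ (-s)) ^ (m + 1) := by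
  have hZ : (∏ p ∈ S, (1 - (p : ℂ) ^ (-s))⁻¹) ≠ 0 :=
    prod_ne_zero_iff.mpr fun p hp => inv_ne_zero (one_sub_primePow_ne_zero (hS p hp) hs)
  rw [(hasDerivAt_partitionFunction hS hs).deriv, neg_mul, neg_neg, mul_div_cancel_left₀ _ hZ]
  exact sum_congr rfl fun p hp => ((hasSum_log_mul_primePow_pow (hS p hp) hs).tsum_eq).symm

end Literature.NumberTheory.BostConnes
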